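import Mathlib.Analysis.Convex.PathConnected
import Mathlib.Analysis.Convex.Topology
import Mathlib.Analysis.Normed.Affine.AddTorsor
import Mathlib.Analysis.Complex.Basic
import Mathlib.Topology.Order.IntermediateValue
import Mathlib.Topology.MetricSpace.Antilipschitz
import Mathlib.Topology.MetricSpace.HausdorffDistance
import HarnessLib

/-!
# Connected subsets of a finite straight-line graph are path connected

Topic: Topology / PlaneTopology.  A planar lemma needed whenever lattice events defined through
*paths* ("an open path, seen as a continuous path in the plane, crossing the quad", DKKMO
arXiv:2012.11672, §1.2 — the tree's `quadCrossing`, via Mathlib's `JoinedIn`) are compared with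
events defined through *continua* ("a crossing is a connected compact subset of `[Q]` meeting
both sides", Schramm–Smirnov, Ann. Probab. 39 (2011), §1.3, who add: "in the discrete setting
there is no difference between connected and path-connected crossings" — the tree's
`Quad.IsCrossing`), and whenever continuum duality (`RectangleDuality.lean`,
`exists_path_avoiding_of_not_crossed`, stated with preconnected subsets) is run on drawn lattice
configurations.

**Theorem** (`SegmentGraph.isPathConnected_of_isConnected`).  Let `[aᵢ, bᵢ]`, `i ∈ ι` finite,
be non-degenerate closed segments of `ℂ` any two of which meet only at common endpoints
(`[aᵢ, bᵢ] ∩ [aⱼ, bⱼ] ⊆ {aᵢ, bᵢ}` for `i ≠ j`) — a finite graph drawn with straight edges.  Then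
every **connected** subset `Z` of `⋃ᵢ [aᵢ, bᵢ]` is path connected (so any two of its points
are joined by a path inside `Z`, `IsPathConnected.joinedIn`); no closedness is needed
(`isPathConnected_iff_isConnected`).

## Proof

Write `φᵢ(t) = aᵢ + t (bᵢ - aᵢ)` (`SegmentGraph.edgeMap`).  Say that a point `φᵢ(t) ∈ Z`,
`0 < t < 1`, is *cut off on the left* if `φᵢ(w) ∉ Z` for some `0 < w < t`, and *on the right*
if `φᵢ(w) ∉ Z` for some `t < w < 1`.
* If some point of `Z` is cut off on both sides, by `w⁻ < t < w⁺`, then `Z ∩ φᵢ((w⁻, w⁺))` is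
  clopen in `Z` (the open sub-arc meets no other edge), so `Z ⊆ φᵢ((w⁻, w⁺))` is the image of
  a connected subset of `ℝ`, an interval: path connected (`subset_image_Ioo_of_cut`,
  `isPathConnected_of_subset_range`).
* Otherwise (no *double cut*) every point of `Z` is *locally joined*: all points of `Z` close
  enough to `z ∈ Z` are joined to `z` by a straight path inside `Z`
  (`exists_joinedIn_of_dist_lt`; at a vertex, points of `Z` on an incident edge approaching the
  vertex with gaps below them would be cut off on the left, hence not on the right, and then
  the gaps of the closer ones would be filled — so near the vertex there are no gaps; at an edge
  point the side without cut gives the path).  Then the set of points joined to a fixed `x₀` is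
  clopen in `Z`, hence all of `Z`.

## References

* O. Schramm, S. Smirnov, *On the scaling limits of planar percolation*, Ann. Probab. 39 (2011),
  §1.3 ("in the discrete setting there is no difference between connected and path-connected
  crossings") [SchrammSmirnov2011].
* K. Kuratowski, *Topology* II (1968), §47 (components versus quasi-components in compact
  spaces) [Kuratowski1968].
-/

noncomputable section

open Set Metric AffineMap

namespace Literature.Topology.PlaneTopology

namespace SegmentGraph

variable {ι : Type*} {a b : ι → ℂ}

/-! ### The edge parametrisations -/

/-- The affine parametrisation `φᵢ = AffineMap.lineMap (a i) (b i)` of the `i`-th edge,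
`φᵢ(t) = aᵢ + t (bᵢ - aᵢ)`, as a local notation (scalars pinned to `ℝ`). -/
local notation "edgeMap[" a ", " b ", " i "]" => (AffineMap.lineMap (a i) (b i) : ℝ →ᵃ[ℝ] ℂ)

/-- `φᵢ(0) = aᵢ`. [folklore] -/
theorem edgeMap_zero (i : ι) : edgeMap[a, b, i] 0 = a i := lineMap_apply_zero _ _

/-- `φᵢ(1) = bᵢ`. [folklore] -/
theorem edgeMap_one (i : ι) : edgeMap[a, b, i] 1 = b i := lineMap_apply_one _ _

/-- `φᵢ(t) = (1 - t) aᵢ + t bᵢ`. [folklore] -/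
theorem edgeMap_apply (i : ι) (t : ℝ) : edgeMap[a, b, i] t = (1 - t) • a i + t • b i :=
  lineMap_apply_module _ _ _

/-- `dist (φᵢ s) (φᵢ t) = |s - t| · dist aᵢ bᵢ`. [folklore] -/
theorem dist_edgeMap (i : ι) (s t : ℝ) :
    dist (edgeMap[a, b, i] s) (edgeMap[a, b, i] t) = dist s t * dist (a i) (b i) :=
  dist_lineMap_lineMap _ _ _ _

/-- The segment `[aᵢ, bᵢ]` is `φᵢ([0, 1])`. [folklore] -/
theorem segment_eq_image (i : ι) : segment ℝ (a i) (b i) = edgeMap[a, b, i] '' Icc 0 1 :=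
  segment_eq_image_lineMap ℝ (a i) (b i)

/-- Sub-segments: `[φᵢ s, φᵢ t] ⊆ φᵢ([s, t] ∪ [t, s])`. [folklore] -/
theorem segment_edgeMap_subset (i : ι) (s t : ℝ) :
    segment ℝ (edgeMap[a, b, i] s) (edgeMap[a, b, i] t) ⊆ edgeMap[a, b, i] '' uIcc s t := by
  rw [segment_eq_image_lineMap]
  rintro _ ⟨r, hr, rfl⟩
  refine ⟨(1 - r) * s + r * t, ?_, ?_⟩
  · rcases le_total s t with hst | hts
    · rw [uIcc_of_le hst]
      constructor <;> nlinarith [hr.1, hr.2]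
    · rw [uIcc_of_ge hts]
      constructor <;> nlinarith [hr.1, hr.2]
  · simp only [lineMap_apply_module, Complex.real_smul]
    push_cast
    ring

/-- For a non-degenerate edge, `φᵢ` is injective. [folklore] -/
theorem injective_edgeMap {i : ι} (hab : a i ≠ b i) : Function.Injective edgeMap[a, b, i] := by
  intro s t h
  have key := dist_edgeMap (a := a) (b := b) i s t
  rw [h, dist_self] at key
  have hd : 0 < dist (a i) (b i) := dist_pos.2 hab
  have h0 : dist s t = 0 := by
    by_contra hne
    have : 0 < dist s t := lt_of_le_of_ne dist_nonneg (Ne.symm hne)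
    nlinarith
  exact dist_eq_zero.1 h0

/-- For a non-degenerate edge, `φᵢ` expands distances by the fixed factor `dist aᵢ bᵢ`; in
particular it is antilipschitz. [folklore] -/
theorem antilipschitz_edgeMap {i : ι} (hab : a i ≠ b i) :
    AntilipschitzWith (Real.toNNReal (dist (a i) (b i))⁻¹) edgeMap[a, b, i] := by
  refine AntilipschitzWith.of_le_mul_dist fun s t ↦ ?_
  have hd : 0 < dist (a i) (b i) := dist_pos.2 hab
  rw [dist_edgeMap, Real.coe_toNNReal _ (inv_nonneg.2 hd.le)]
  have : (dist (a i) (b i))⁻¹ * (dist s t * dist (a i) (b i)) = dist s t := by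
    field_simp
  rw [this]

/-- For a non-degenerate edge, `φᵢ` is a closed map (a closed embedding of `ℝ` into `ℂ`).
[folklore] -/
theorem isClosedMap_edgeMap {i : ι} (hab : a i ≠ b i) : IsClosedMap edgeMap[a, b, i] := by
  have huc : UniformContinuous edgeMap[a, b, i] := (lipschitzWith_lineMap (a i) (b i)).uniformContinuous
  exact ((antilipschitz_edgeMap hab).isClosedEmbedding huc).isClosedMap

/-- An interior point of an edge lies on no other edge (edges meet only at common endpoints).
[folklore] -/
theorem edgeMap_not_mem_segment
    (hint : ∀ i j, i ≠ j → segment ℝ (a i) (b i) ∩ segment ℝ (a j) (b j) ⊆ {a i, b i})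
    {i j : ι} (hij : i ≠ j) (hab : a i ≠ b i) {t : ℝ} (ht : t ∈ Ioo (0 : ℝ) 1) :
    edgeMap[a, b, i] t ∉ segment ℝ (a j) (b j) := by
  intro hmem
  have hi : edgeMap[a, b, i] t ∈ segment ℝ (a i) (b i) := by
    rw [segment_eq_image]
    exact mem_image_of_mem _ ⟨ht.1.le, ht.2.le⟩
  rcases hint i j hij ⟨hi, hmem⟩ with h | h
  · exact ht.1.ne' (injective_edgeMap hab (h.trans (edgeMap_zero i).symm))
  · rw [mem_singleton_iff] at h
    exact ht.2.ne (injective_edgeMap hab (h.trans (edgeMap_one i).symm))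

/-! ### A connected set inside one edge is path connected -/

/-- A preconnected nonempty subset of a single (non-degenerate) edge is path connected: its
preimage under `φᵢ`, a closed embedding, is a preconnected subset of `ℝ`, an interval.
[folklore] -/
theorem isPathConnected_of_subset_range {i : ι} (hab : a i ≠ b i) {Z : Set ℂ}
    (hZ : IsPreconnected Z) (hne : Z.Nonempty) (hZi : Z ⊆ range edgeMap[a, b, i]) :
    IsPathConnected Z := by
  have hT : IsPreconnected (edgeMap[a, b, i] ⁻¹' Z) :=
    hZ.preimage_of_isClosedMap (injective_edgeMap hab) (isClosedMap_edgeMap hab) hZi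
  have hTne : (edgeMap[a, b, i] ⁻¹' Z).Nonempty := by
    obtain ⟨z, hz⟩ := hne
    obtain ⟨t, rfl⟩ := hZi hz
    exact ⟨t, hz⟩
  have hTpc : IsPathConnected (edgeMap[a, b, i] ⁻¹' Z) :=
    (Real.convex_iff_isPreconnected.2 hT).isPathConnected hTne
  have := hTpc.image (lineMap_continuous : Continuous edgeMap[a, b, i])
  rwa [image_preimage_eq_of_subset hZi] at this

/-! ### A point cut off on both sides pins the whole set into an open sub-arc -/

/-- **Two-sided cut.** If `φᵢ(w⁻) ∉ Z` and `φᵢ(w⁺) ∉ Z` with `0 < w⁻ < w⁺ < 1`, and the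
preconnected set `Z ⊆ ⋃ⱼ [aⱼ, bⱼ]` meets the open sub-arc `φᵢ((w⁻, w⁺))`, then
`Z ⊆ φᵢ((w⁻, w⁺))`: the trace of `Z` on this sub-arc is clopen in `Z`, the sub-arc meeting no
other edge. [folklore] -/
theorem subset_image_Ioo_of_cut [Finite ι] (hab : ∀ i, a i ≠ b i)
    (hint : ∀ i j, i ≠ j → segment ℝ (a i) (b i) ∩ segment ℝ (a j) (b j) ⊆ {a i, b i})
    {Z : Set ℂ} (hZ : IsPreconnected Z) (hZG : Z ⊆ ⋃ i, segment ℝ (a i) (b i))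
    {i : ι} {wl wr : ℝ} (hwl : 0 < wl) (hlr : wl < wr) (hwr : wr < 1)
    (hl : edgeMap[a, b, i] wl ∉ Z) (hr : edgeMap[a, b, i] wr ∉ Z)
    (hne : (Z ∩ edgeMap[a, b, i] '' Ioo wl wr).Nonempty) :
    Z ⊆ edgeMap[a, b, i] '' Ioo wl wr := by
  classical
  set φ := edgeMap[a, b, i] with hφ
  -- the complement of the rest of the graph
  set R : Set ℂ := φ '' Icc 0 wl ∪ φ '' Icc wr 1 ∪ ⋃ j ∈ {j | j ≠ i}, segment ℝ (a j) (b j)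
    with hR
  have hRc : IsClosed R := by
    refine (IsClosed.union ?_ ?_).union ?_
    · exact (isCompact_Icc.image lineMap_continuous).isClosed
    · exact (isCompact_Icc.image lineMap_continuous).isClosed
    · refine (Set.toFinite {j | j ≠ i}).isClosed_biUnion fun j _ ↦ ?_
      rw [segment_eq_image_lineMap]
      exact (isCompact_Icc.image AffineMap.lineMap_continuous).isClosed
  set u : Set ℂ := Rᶜ with hu
  set v : Set ℂ := (φ '' Icc wl wr)ᶜ with hv
  have huo : IsOpen u := hRc.isOpen_compl
  have hvo : IsOpen v := (isCompact_Icc.image lineMap_continuous).isClosed.isOpen_compl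
  -- the open sub-arc lies in `u`
  have hsub_u : φ '' Ioo wl wr ⊆ u := by
    rintro _ ⟨t, ht, rfl⟩ hmem
    have ht01 : t ∈ Ioo (0 : ℝ) 1 := ⟨hwl.trans ht.1, ht.2.trans hwr⟩
    rcases hmem with (⟨s, hs, hst⟩ | ⟨s, hs, hst⟩) | hmem
    · have := injective_edgeMap (hab i) hst
      rw [this] at hs
      exact (not_lt.2 hs.2) ht.1
    · have := injective_edgeMap (hab i) hst
      rw [this] at hs
      exact (not_lt.2 hs.1) ht.2
    · simp only [mem_iUnion, mem_setOf_eq, exists_prop] at hmem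
      obtain ⟨j, hji, hmem⟩ := hmem
      exact edgeMap_not_mem_segment hint (Ne.symm hji) (hab i) ht01 hmem
  -- `Z ⊆ u ∪ v`
  have hZuv : Z ⊆ u ∪ v := by
    intro z hz
    by_cases hzv : z ∈ φ '' Icc wl wr
    · obtain ⟨t, ht, rfl⟩ := hzv
      have htl : t ≠ wl := by rintro rfl; exact hl hz
      have htr : t ≠ wr := by rintro rfl; exact hr hz
      exact Or.inl (hsub_u ⟨t, ⟨lt_of_le_of_ne ht.1 (Ne.symm htl), lt_of_le_of_ne ht.2 htr⟩, rfl⟩)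
    · exact Or.inr hzv
  -- `Z ∩ (u ∩ v) = ∅`
  have hZdisj : ¬ (Z ∩ (u ∩ v)).Nonempty := by
    rintro ⟨z, hz, hzu, hzv⟩
    obtain ⟨k, hk⟩ := mem_iUnion.1 (hZG hz)
    by_cases hki : k = i
    · subst hki
      rw [segment_eq_image] at hk
      obtain ⟨t, ht, rfl⟩ := hk
      apply hzv
      refine ⟨t, ⟨?_, ?_⟩, rfl⟩
      · by_contra hlt
        exact hzu (Or.inl (Or.inl ⟨t, ⟨ht.1, (not_le.1 hlt).le⟩, rfl⟩))
      · by_contra hlt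
        exact hzu (Or.inl (Or.inr ⟨t, ⟨(not_le.1 hlt).le, ht.2⟩, rfl⟩))
    · apply hzu
      refine Or.inr ?_
      simp only [mem_iUnion, mem_setOf_eq, exists_prop]
      exact ⟨k, hki, hk⟩
  -- preconnectedness
  have hZu : (Z ∩ u).Nonempty := by
    obtain ⟨z, hz, hzφ⟩ := hne
    exact ⟨z, hz, hsub_u hzφ⟩
  have hZv : ¬ (Z ∩ v).Nonempty := fun h ↦ hZdisj (hZ u v huo hvo hZuv hZu h)
  intro z hz
  have hzv : z ∈ φ '' Icc wl wr := by
    by_contra h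
    exact hZv ⟨z, hz, h⟩
  obtain ⟨t, ht, rfl⟩ := hzv
  have htl : t ≠ wl := by rintro rfl; exact hl hz
  have htr : t ≠ wr := by rintro rfl; exact hr hz
  exact ⟨t, ⟨lt_of_le_of_ne ht.1 (Ne.symm htl), lt_of_le_of_ne ht.2 htr⟩, rfl⟩

/-! ### No double cuts: local joinability -/

/-- A straight path inside `Z`: if `φᵢ(w) ∈ Z` for all `w` between `s` and `t`, then `φᵢ(s)`
and `φᵢ(t)` are joined in `Z`. [folklore] -/
theorem joinedIn_of_forall_mem {Z : Set ℂ} {i : ι} {s t : ℝ}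
    (h : ∀ w ∈ uIcc s t, edgeMap[a, b, i] w ∈ Z) : JoinedIn Z (edgeMap[a, b, i] s) (edgeMap[a, b, i] t) :=
  JoinedIn.of_segment_subset ((segment_edgeMap_subset i s t).trans (by
    rintro _ ⟨w, hw, rfl⟩; exact h w hw))

/-- Reversing an edge: `φ` for `(b, a)` is `φ` for `(a, b)` at `1 - t`. [folklore] -/
theorem edgeMap_swap (i : ι) (t : ℝ) : edgeMap[b, a, i] t = edgeMap[a, b, i] (1 - t) :=
  (lineMap_apply_one_sub (a i) (b i) t).symm

/-- Local joinability at an interior point of an edge, right side free: if `z = φᵢ(τ) ∈ Z`,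
`0 < τ < 1`, and `φᵢ(w) ∈ Z` for all `τ < w < 1`, then all points `φᵢ(s) ∈ Z`, `0 ≤ s ≤ 1`,
close enough to `z` are joined to `z` inside `Z`. [folklore] -/
theorem exists_joined_of_right_free {Z : Set ℂ} (hno : ∀ i, ∀ t ∈ Ioo (0 : ℝ) 1, edgeMap[a, b, i] t ∈ Z → (∃ w ∈ Ioo 0 t, edgeMap[a, b, i] w ∉ Z) →
      ∀ w ∈ Ioo t 1, edgeMap[a, b, i] w ∈ Z)
    {i : ι} (hab : a i ≠ b i) {τ : ℝ} (hτ : τ ∈ Ioo (0 : ℝ) 1) (hz : edgeMap[a, b, i] τ ∈ Z)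
    (hR : ∀ w ∈ Ioo τ 1, edgeMap[a, b, i] w ∈ Z) :
    ∃ ε > 0, ∀ s ∈ Icc (0 : ℝ) 1, edgeMap[a, b, i] s ∈ Z → dist (edgeMap[a, b, i] s) (edgeMap[a, b, i] τ) < ε →
      JoinedIn Z (edgeMap[a, b, i] τ) (edgeMap[a, b, i] s) := by
  have hd : 0 < dist (a i) (b i) := dist_pos.2 hab
  -- points on the right of `τ` are joined
  have hright : ∀ s ∈ Icc (0 : ℝ) 1, edgeMap[a, b, i] s ∈ Z → τ ≤ s →
      JoinedIn Z (edgeMap[a, b, i] τ) (edgeMap[a, b, i] s) := by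
    intro s hs hsZ hτs
    refine joinedIn_of_forall_mem fun w hw ↦ ?_
    rw [uIcc_of_le hτs] at hw
    rcases eq_or_lt_of_le hw.1 with rfl | hτw
    · exact hz
    rcases eq_or_lt_of_le hw.2 with rfl | hws
    · exact hsZ
    exact hR w ⟨hτw, hws.trans_le hs.2⟩
  by_cases hL : ∀ w ∈ Ioo 0 τ, edgeMap[a, b, i] w ∈ Z
  · -- both sides free: every point of the edge in `Z` is joined
    refine ⟨1, one_pos, fun s hs hsZ _ ↦ ?_⟩
    rcases le_total τ s with hτs | hsτ
    · exact hright s hs hsZ hτs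
    · refine joinedIn_of_forall_mem fun w hw ↦ ?_
      rw [uIcc_of_ge hsτ] at hw
      rcases eq_or_lt_of_le hw.1 with rfl | hsw
      · exact hsZ
      rcases eq_or_lt_of_le hw.2 with rfl | hwτ
      · exact hz
      exact hL w ⟨hs.1.trans_lt hsw, hwτ⟩
  · -- a gap `w₀` on the left: only points above `w₀` matter, and they are right-free
    push Not at hL
    obtain ⟨w₀, hw₀, hw₀Z⟩ := hL
    refine ⟨(τ - w₀) * dist (a i) (b i), mul_pos (by linarith [hw₀.2]) hd, fun s hs hsZ hdist ↦ ?_⟩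
    rcases le_total τ s with hτs | hsτ
    · exact hright s hs hsZ hτs
    · rw [dist_edgeMap, Real.dist_eq, abs_of_nonpos (by linarith)] at hdist
      have hws : w₀ < s := by nlinarith
      rcases eq_or_lt_of_le hsτ with rfl | hsτ'
      · exact JoinedIn.refl hz
      have hs01 : s ∈ Ioo (0 : ℝ) 1 := ⟨hw₀.1.trans hws, hsτ'.trans hτ.2⟩
      have hRs := hno i s hs01 hsZ ⟨w₀, ⟨hw₀.1, hws⟩, hw₀Z⟩
      refine joinedIn_of_forall_mem fun w hw ↦ ?_
      rw [uIcc_of_ge hsτ] at hw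
      rcases eq_or_lt_of_le hw.1 with rfl | hsw
      · exact hsZ
      rcases eq_or_lt_of_le hw.2 with rfl | hwτ
      · exact hz
      exact hRs w ⟨hsw, hwτ.trans hτ.2⟩

/-- Local joinability at the initial vertex of an edge: if `aᵢ = φᵢ(0) ∈ Z`, then all points
`φᵢ(s) ∈ Z` close enough to `aᵢ` are joined to `aᵢ` inside `Z` (near the vertex there are no
gaps: a point with a gap below it is cut off on the left, hence right-free, which fills the gaps
below all closer such points). [folklore] -/
theorem exists_joined_at_vertex {Z : Set ℂ} (hno : ∀ i, ∀ t ∈ Ioo (0 : ℝ) 1, edgeMap[a, b, i] t ∈ Z → (∃ w ∈ Ioo 0 t, edgeMap[a, b, i] w ∉ Z) →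
      ∀ w ∈ Ioo t 1, edgeMap[a, b, i] w ∈ Z)
    {i : ι} (hab : a i ≠ b i) (hz : edgeMap[a, b, i] 0 ∈ Z) :
    ∃ ε > 0, ∀ s ∈ Icc (0 : ℝ) 1, edgeMap[a, b, i] s ∈ Z → dist (edgeMap[a, b, i] s) (edgeMap[a, b, i] 0) < ε →
      JoinedIn Z (edgeMap[a, b, i] 0) (edgeMap[a, b, i] s) := by
  have hd : 0 < dist (a i) (b i) := dist_pos.2 hab
  -- no left cuts near `0`
  have key : ∃ σ ∈ Ioc (0 : ℝ) 1, ∀ s ∈ Ioo (0 : ℝ) 1, s < σ → edgeMap[a, b, i] s ∈ Z →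
      ∀ w ∈ Ioo 0 s, edgeMap[a, b, i] w ∈ Z := by
    by_contra hcon
    push Not at hcon
    obtain ⟨s₁, hs₁, -, hs₁Z, w₁, hw₁, hw₁Z⟩ := hcon 1 ⟨one_pos, le_rfl⟩
    obtain ⟨s₂, hs₂, hs₂w, hs₂Z, w₂, hw₂, hw₂Z⟩ := hcon w₁ ⟨hw₁.1, (hw₁.2.trans hs₁.2).le⟩
    have hR₂ := hno i s₂ hs₂ hs₂Z ⟨w₂, hw₂, hw₂Z⟩
    exact hw₁Z (hR₂ w₁ ⟨hs₂w, hw₁.2.trans hs₁.2⟩)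
  obtain ⟨σ, hσ, hkey⟩ := key
  refine ⟨σ * dist (a i) (b i), mul_pos hσ.1 hd, fun s hs hsZ hdist ↦ ?_⟩
  rw [dist_edgeMap, Real.dist_eq, sub_zero, abs_of_nonneg hs.1] at hdist
  have hsσ : s < σ := lt_of_mul_lt_mul_right hdist hd.le
  refine joinedIn_of_forall_mem fun w hw ↦ ?_
  rw [uIcc_of_le hs.1] at hw
  rcases eq_or_lt_of_le hw.1 with rfl | h0w
  · exact hz
  rcases eq_or_lt_of_le hw.2 with rfl | hws
  · exact hsZ
  have hs01 : s ∈ Ioo (0 : ℝ) 1 := ⟨h0w.trans hws, lt_of_lt_of_le hsσ hσ.2⟩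
  exact hkey s hs01 hsσ hsZ w ⟨h0w, hws⟩

/-- Reversing all edges preserves the no-double-cut condition ("a point cut off on the left is
not cut off on the right"): a left cut becomes a right cut. [folklore] -/
theorem noDoubleCut_swap {Z : Set ℂ}
    (hno : ∀ i, ∀ t ∈ Ioo (0 : ℝ) 1, edgeMap[a, b, i] t ∈ Z → (∃ w ∈ Ioo 0 t, edgeMap[a, b, i] w ∉ Z) →
      ∀ w ∈ Ioo t 1, edgeMap[a, b, i] w ∈ Z) :
    ∀ i, ∀ t ∈ Ioo (0 : ℝ) 1, edgeMap[b, a, i] t ∈ Z → (∃ w ∈ Ioo 0 t, edgeMap[b, a, i] w ∉ Z) →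
      ∀ w ∈ Ioo t 1, edgeMap[b, a, i] w ∈ Z := by
  intro i t ht htZ hcut w hw
  rw [edgeMap_swap] at htZ ⊢
  -- in the original orientation `1 - t` is cut off on the right, hence not on the left
  by_contra hwZ
  obtain ⟨w', hw', hw'Z⟩ := hcut
  rw [edgeMap_swap] at hw'Z
  have h1t : 1 - t ∈ Ioo (0 : ℝ) 1 := ⟨by linarith [ht.2], by linarith [ht.1]⟩
  -- `1 - w` is a left gap for `1 - t`; then the right side of `1 - t` is free, containing `1 - w'`
  have hR := hno i (1 - t) h1t htZ ⟨1 - w, ⟨by linarith [hw.2], by linarith [hw.1]⟩, hwZ⟩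
  exact hw'Z (hR (1 - w') ⟨by linarith [hw'.2], by linarith [hw'.1]⟩)

/-- **Local joinability.**  If `Z ⊆ ⋃ⱼ [aⱼ, bⱼ]` has no double cut, every point `z ∈ Z` has a
neighbourhood all of whose points in `Z` are joined to `z` inside `Z`. [folklore] -/
theorem exists_joinedIn_of_dist_lt [Finite ι] (hab : ∀ i, a i ≠ b i)
    {Z : Set ℂ} (hZG : Z ⊆ ⋃ i, segment ℝ (a i) (b i))
    (hno : ∀ i, ∀ t ∈ Ioo (0 : ℝ) 1, edgeMap[a, b, i] t ∈ Z → (∃ w ∈ Ioo 0 t, edgeMap[a, b, i] w ∉ Z) →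
      ∀ w ∈ Ioo t 1, edgeMap[a, b, i] w ∈ Z) {z : ℂ} (hz : z ∈ Z) :
    ∃ ε > 0, ∀ z' ∈ Z, dist z' z < ε → JoinedIn Z z z' := by
  classical
  haveI := Fintype.ofFinite ι
  -- per edge
  have hedge : ∀ j, ∃ ε > 0, ∀ s ∈ Icc (0 : ℝ) 1, edgeMap[a, b, j] s ∈ Z →
      dist (edgeMap[a, b, j] s) z < ε → JoinedIn Z z (edgeMap[a, b, j] s) := by
    intro j
    by_cases hzj : z ∈ segment ℝ (a j) (b j)
    · rw [segment_eq_image] at hzj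
      obtain ⟨τ, hτ, rfl⟩ := hzj
      rcases eq_or_lt_of_le hτ.1 with rfl | h0τ
      · -- initial vertex
        exact exists_joined_at_vertex hno (hab j) hz
      rcases eq_or_lt_of_le hτ.2 with rfl | hτ1
      · -- final vertex: reverse the edges
        have e0 : edgeMap[b, a, j] 0 = edgeMap[a, b, j] 1 := by rw [edgeMap_swap, sub_zero]
        obtain ⟨ε, hε, h⟩ := exists_joined_at_vertex (a := b) (b := a) (noDoubleCut_swap hno)
          (Ne.symm (hab j)) (by rwa [e0])
        refine ⟨ε, hε, fun s hs hsZ hdist ↦ ?_⟩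
        have h1s : 1 - s ∈ Icc (0 : ℝ) 1 := ⟨by linarith [hs.2], by linarith [hs.1]⟩
        have es : edgeMap[b, a, j] (1 - s) = edgeMap[a, b, j] s := by rw [edgeMap_swap, sub_sub_cancel]
        have := h (1 - s) h1s (by rwa [es]) (by rwa [es, e0])
        rwa [es, e0] at this
      -- interior point: one side is free
      have hτ01 : τ ∈ Ioo (0 : ℝ) 1 := ⟨h0τ, hτ1⟩
      by_cases hcutL : ∃ w ∈ Ioo 0 τ, edgeMap[a, b, j] w ∉ Z
      · exact exists_joined_of_right_free hno (hab j) hτ01 hz (hno j τ hτ01 hz hcutL)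
      · -- left side free: reverse the edges
        push Not at hcutL
        have h1τ : 1 - τ ∈ Ioo (0 : ℝ) 1 := ⟨by linarith, by linarith⟩
        have hz' : edgeMap[b, a, j] (1 - τ) ∈ Z := by rwa [edgeMap_swap, sub_sub_cancel]
        have hR' : ∀ w ∈ Ioo (1 - τ) 1, edgeMap[b, a, j] w ∈ Z := by
          intro w hw
          rw [edgeMap_swap]
          exact hcutL (1 - w) ⟨by linarith [hw.2], by linarith [hw.1]⟩
        obtain ⟨ε, hε, h⟩ := exists_joined_of_right_free (a := b) (b := a) (noDoubleCut_swap hno)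
          (Ne.symm (hab j)) h1τ hz' hR'
        refine ⟨ε, hε, fun s hs hsZ hdist ↦ ?_⟩
        have h1s : 1 - s ∈ Icc (0 : ℝ) 1 := ⟨by linarith [hs.2], by linarith [hs.1]⟩
        have es : edgeMap[b, a, j] (1 - s) = edgeMap[a, b, j] s := by rw [edgeMap_swap, sub_sub_cancel]
        have eτ : edgeMap[b, a, j] (1 - τ) = edgeMap[a, b, j] τ := by rw [edgeMap_swap, sub_sub_cancel]
        have := h (1 - s) h1s (by rwa [es]) (by rwa [es, eτ])
        rwa [es, eτ] at this
    · -- an edge missing `z`: positive distance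
      have hpos : 0 < infDist z (segment ℝ (a j) (b j)) :=
        (IsClosed.notMem_iff_infDist_pos (by
          rw [segment_eq_image_lineMap]
          exact (isCompact_Icc.image AffineMap.lineMap_continuous).isClosed)
          ⟨a j, left_mem_segment _ _ _⟩).1 hzj
      refine ⟨infDist z (segment ℝ (a j) (b j)), hpos, fun s hs _ hdist ↦ ?_⟩
      exfalso
      have : infDist z (segment ℝ (a j) (b j)) ≤ dist z (edgeMap[a, b, j] s) :=
        infDist_le_dist_of_mem (by rw [segment_eq_image]; exact mem_image_of_mem _ hs)
      rw [dist_comm] at this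
      linarith
  choose ε hε hjoin using hedge
  by_cases hι : Nonempty ι
  swap
  · exfalso
    obtain ⟨k, -⟩ := mem_iUnion.1 (hZG hz)
    exact hι ⟨k⟩
  refine ⟨Finset.univ.inf' Finset.univ_nonempty ε, (Finset.lt_inf'_iff _).2 fun j _ ↦ hε j,
    fun z' hz' hdist ↦ ?_⟩
  obtain ⟨j, hj⟩ := mem_iUnion.1 (hZG hz')
  rw [segment_eq_image] at hj
  obtain ⟨s, hs, rfl⟩ := hj
  exact hjoin j s hs hz' (hdist.trans_le (Finset.inf'_le _ (Finset.mem_univ j)))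

/-! ### The theorem -/

/-- **Connected subsets of a finite straight-line graph are path connected.**  Let `[aᵢ, bᵢ]`
(`i ∈ ι` finite) be non-degenerate segments of `ℂ`, any two meeting only at common endpoints.
Then every connected `Z ⊆ ⋃ᵢ [aᵢ, bᵢ]` is path connected.  (Schramm–Smirnov 2011, §1.3: "in
the discrete setting there is no difference between connected and path-connected crossings".)
[cite: SchrammSmirnov2011, §1.3] -/
theorem isPathConnected_of_isConnected [Finite ι] (hab : ∀ i, a i ≠ b i)
    (hint : ∀ i j, i ≠ j → segment ℝ (a i) (b i) ∩ segment ℝ (a j) (b j) ⊆ {a i, b i})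
    {Z : Set ℂ} (hZ : IsConnected Z) (hZG : Z ⊆ ⋃ i, segment ℝ (a i) (b i)) :
    IsPathConnected Z := by
  classical
  by_cases hcut : ∃ i, ∃ t ∈ Ioo (0 : ℝ) 1, edgeMap[a, b, i] t ∈ Z ∧
      (∃ w ∈ Ioo 0 t, edgeMap[a, b, i] w ∉ Z) ∧ (∃ w ∈ Ioo t 1, edgeMap[a, b, i] w ∉ Z)
  · -- a double cut: `Z` lies in one open sub-arc
    obtain ⟨i, t, ht, htZ, ⟨wl, hwl, hwlZ⟩, ⟨wr, hwr, hwrZ⟩⟩ := hcut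
    have hsub := subset_image_Ioo_of_cut hab hint hZ.isPreconnected hZG hwl.1
      (hwl.2.trans hwr.1) hwr.2 hwlZ hwrZ ⟨_, htZ, t, ⟨hwl.2, hwr.1⟩, rfl⟩
    exact isPathConnected_of_subset_range (hab i) hZ.isPreconnected hZ.nonempty
      (hsub.trans (image_subset_range _ _))
  · -- no double cut: local joinability and connectedness
    have hno : ∀ i, ∀ t ∈ Ioo (0 : ℝ) 1, edgeMap[a, b, i] t ∈ Z → (∃ w ∈ Ioo 0 t, edgeMap[a, b, i] w ∉ Z) →
        ∀ w ∈ Ioo t 1, edgeMap[a, b, i] w ∈ Z := by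
      intro i t ht htZ hL w hw
      by_contra hwZ
      exact hcut ⟨i, t, ht, htZ, hL, w, hw, hwZ⟩
    obtain ⟨x₀, hx₀⟩ := hZ.nonempty
    have hloc := fun z (hz : z ∈ Z) ↦ exists_joinedIn_of_dist_lt hab hZG hno hz
    choose! ε hε hjoin using hloc
    set P : Set ℂ := {y ∈ Z | JoinedIn Z x₀ y} with hP
    set u : Set ℂ := ⋃ y ∈ P, ball y (ε y) with hu
    set v : Set ℂ := ⋃ y ∈ Z \ P, ball y (ε y) with hv
    have huo : IsOpen u := isOpen_biUnion fun _ _ ↦ isOpen_ball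
    have hvo : IsOpen v := isOpen_biUnion fun _ _ ↦ isOpen_ball
    have hZuv : Z ⊆ u ∪ v := by
      intro z hz
      by_cases hzP : z ∈ P
      · exact Or.inl (mem_biUnion hzP (mem_ball_self (hε z hz)))
      · exact Or.inr (mem_biUnion ⟨hz, hzP⟩ (mem_ball_self (hε z hz)))
    have hZu : (Z ∩ u).Nonempty :=
      ⟨x₀, hx₀, mem_biUnion (show x₀ ∈ P from ⟨hx₀, JoinedIn.refl hx₀⟩) (mem_ball_self (hε x₀ hx₀))⟩
    have hdisj : ¬ (Z ∩ (u ∩ v)).Nonempty := by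
      rintro ⟨z, hz, hzu, hzv⟩
      simp only [hu, hv, mem_iUnion, exists_prop] at hzu hzv
      obtain ⟨y, hyP, hzy⟩ := hzu
      obtain ⟨y', hy'P, hzy'⟩ := hzv
      have h1 : JoinedIn Z y z := hjoin y hyP.1 z hz (mem_ball.1 hzy)
      have h2 : JoinedIn Z y' z := hjoin y' hy'P.1 z hz (mem_ball.1 hzy')
      exact hy'P.2 ⟨hy'P.1, (hyP.2.trans h1).trans h2.symm⟩
    have hZv : ¬ (Z ∩ v).Nonempty := fun h ↦ hdisj (hZ.isPreconnected u v huo hvo hZuv hZu h)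
    refine ⟨x₀, hx₀, fun y hy ↦ ?_⟩
    by_contra hyP
    exact hZv ⟨y, hy, mem_biUnion (show y ∈ Z \ P from ⟨hy, fun h ↦ hyP h.2⟩) (mem_ball_self (hε y hy))⟩

/-- **Preconnected subsets of a finite straight-line graph are path connected** (nonempty
ones); in particular two sets both met by a preconnected `S ⊆ ⋃ᵢ [aᵢ, bᵢ]` are joined by a path
inside `S` (`IsPathConnected.joinedIn`). [cite: SchrammSmirnov2011, §1.3] -/
theorem isPathConnected_of_isPreconnected [Finite ι] (hab : ∀ i, a i ≠ b i)
    (hint : ∀ i j, i ≠ j → segment ℝ (a i) (b i) ∩ segment ℝ (a j) (b j) ⊆ {a i, b i})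
    {S : Set ℂ} (hS : IsPreconnected S) (hne : S.Nonempty) (hSG : S ⊆ ⋃ i, segment ℝ (a i) (b i)) :
    IsPathConnected S :=
  isPathConnected_of_isConnected hab hint ⟨hne, hS⟩ hSG

/-- In a finite straight-line graph, connectedness and path connectedness of subsets agree.
[cite: SchrammSmirnov2011, §1.3] -/
theorem isPathConnected_iff_isConnected [Finite ι] (hab : ∀ i, a i ≠ b i)
    (hint : ∀ i j, i ≠ j → segment ℝ (a i) (b i) ∩ segment ℝ (a j) (b j) ⊆ {a i, b i})
    {Z : Set ℂ} (hZG : Z ⊆ ⋃ i, segment ℝ (a i) (b i)) : IsPathConnected Z ↔ IsConnected Z :=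
  ⟨IsPathConnected.isConnected, fun h ↦ isPathConnected_of_isConnected hab hint h hZG⟩

end SegmentGraph

end Literature.Topology.PlaneTopology

end
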